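import Literature.AlgebraicGeometry.AbelianSchemes.AbelianSchemeBaseQuotientDescent
import HarnessLib

/-!
# Homomorphisms and sections descend along a free finite quotient OF THE BASE
# ([MFK94] Ch. 7 §1 Prop. 7.1 / §3 Lemma 7.11; SGA 1 VIII 7.8 — finite-group form)

Topic `AlgebraicGeometry/AbelianSchemes`; namespace `Literature.AlgebraicGeometry.AbelianSchemes.AbelianSchemeOver`.
THEOREMS ONLY (no definition, no named fact, no instance, no notation, no `sorry`; net Literature debt 0).
Cell hodgecm-mathlib (D-0151), F-DAG price sheet leaf F-10 (10a) «the universal triple DESCENDS along the free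
finite quotient of the base `M → M/Γ`», second instalment (after ★ `AbelianSchemeBaseQuotientDescent`: the abelian
scheme and its group law descend).  HC_CM is proved only modulo the 7 printed citations until rung 0 closes; this
file discharges none of them (count-neutral capital).

SETTING.  `p : S → Q` an AFFINE geometric quotient of the base by a FREE action `ρ` of the finite group `G`; abelian
schemes `A₁, A₂ / S` and `B₁, B₂ / Q` with `πᵢ : Aᵢ → Bᵢ` exhibiting `Aᵢ` as the base change of `Bᵢ` along `p` AS
GROUP SCHEMES (★ `IsBaseChangeVia` — e.g. produced by ★ `exists_grpObj_isBaseChangeVia_of_free_base_quotient`);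
actions `ρAᵢ` of `G` on the total spaces over `πᵢ`, `π₁` a geometric quotient.

* `exists_isMonHom_desc_of_free_base_quotient` — an `S`-HOMOMORPHISM `f : A₁ → A₂` which is `G`-EQUIVARIANT descends
  to a `Q`-homomorphism `f̄ : B₁ → B₂` with `f ≫ π₂ = π₁ ≫ f̄` (e.g. the polarisation `λ : A → Â` of the universal
  triple): `f̄ := desc (f ≫ π₂)` along `π₁`; it is over `Q` and respects units and laws because `π₁`, `p` and
  `A₁ ×_S A₁ → B₁ ×_Q B₁` are EPIMORPHISMS (base changes of the finite flat `p`, ★ `epi_pullbackMap_of_free`) under which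
  the axioms are the images of those of `f` (★ `OverBaseMap.map_comp_whisker{Right,Left}_left`).
* `desc_left_unique_of_free_base_quotient` — such an `f̄` is unique.
* `exists_section_desc_of_free_base_quotient` — a `G`-EQUIVARIANT SECTION `σ : S → A` descends to a section
  `τ : Q → B` with `σ ≫ π = p ≫ τ` (the level structure of the universal triple, section by section).

Mathlib searched (pin): `IsMonHom`, `MonoidalCategory.tensorHom_def`, `Over.comp_left`, `Over.homMk`,
`Flat.epi_of_flat_of_surjective` (all used); Mathlib has no quotients of schemes by finite groups.

## References
* D. Mumford, J. Fogarty, F. Kirwan, *Geometric Invariant Theory*, 3rd ed. (1994), Ch. 7 §1 Prop. 7.1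
  (p. 127); §3, remark after Thm. 7.9 and Lemma 7.11 (pp. 139–140). [MumfordFogartyKirwan1994]
* A. Grothendieck, *SGA 1*, Exp. VIII Cor. 7.8; Exp. V Prop. 2.6, Déf. 2.7. [SGA1]
-/

noncomputable section

universe u

open CategoryTheory Limits AlgebraicGeometry MonoidalCategory CartesianMonoidalCategory MonObj

namespace Literature.AlgebraicGeometry.AbelianSchemes.AbelianSchemeOver

open Literature.AlgebraicGeometry.RelativeSpec Literature.AlgebraicGeometry.RelativeSpec.ActionOver

set_option backward.isDefEq.respectTransparency false

variable {S Q : Scheme.{u}} {p : S ⟶ Q} {G : Type u} [Group G] [Fintype G] {ρ : ActionOver p G}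
  (hq : ρ.IsGeometricQuotient p) [IsAffineHom p]
  (hfree : ∀ (V : Q.Opens), IsAffineOpen V → ∀ g : G, g ≠ 1 →
    Ideal.span (Set.range fun s : Γ(S, p ⁻¹ᵁ V) ↦ ρ.act g V s - s) = ⊤)

/-! ### §1 Homomorphisms descend -/

section Hom

variable {A₁ A₂ : AbelianSchemeOver S} {B₁ B₂ : AbelianSchemeOver Q}
  {π₁ : A₁.X.left ⟶ B₁.X.left} {π₂ : A₂.X.left ⟶ B₂.X.left}
  (h₁ : A₁.IsBaseChangeVia B₁ p π₁) (h₂ : A₂.IsBaseChangeVia B₂ p π₂)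
  {ρA₁ : ActionOver π₁ G} (hπ₁ : ρA₁.IsGeometricQuotient π₁) (ρA₂ : ActionOver π₂ G)
  [B₂.X.left.IsSeparated]

include hq hfree h₁ h₂ hπ₁ in
/-- **AN EQUIVARIANT HOMOMORPHISM DESCENDS ALONG A FREE FINITE QUOTIENT OF THE BASE.**  In the SETTING of the module
docstring, an `S`-homomorphism `f : A₁ → A₂` (Mathlib `IsMonHom`) with `ρA₁(g) ≫ f = f ≫ ρA₂(g)` for all `g` descends to a
`Q`-HOMOMORPHISM `f̄ : B₁ → B₂` with `f ≫ π₂ = π₁ ≫ f̄`.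
[cite: MumfordFogartyKirwan1994, Ch. 7 §1 Prop. 7.1 (p. 127) and §3 Lemma 7.11 (p. 140)] [cite: SGA1, Exp. VIII Cor. 7.8] -/
theorem exists_isMonHom_desc_of_free_base_quotient (f : A₁.X ⟶ A₂.X) [IsMonHom f]
    (hf : ∀ g : G, (ρA₁.aut g).hom ≫ f.left = f.left ≫ (ρA₂.aut g).hom) :
    ∃ fB : B₁.X ⟶ B₂.X, IsMonHom fB ∧ f.left ≫ π₂ = π₁ ≫ fB.left := by
  obtain ⟨w₁, H₁, u₁, m₁⟩ := h₁
  obtain ⟨w₂, H₂, u₂, m₂⟩ := h₂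
  -- epimorphisms: `p`, `π₁`, `A₁ ×_S A₁ → B₁ ×_Q B₁`
  haveI : Flat p := hq.flat_of_free hfree
  haveI : Surjective p := ⟨hq.surjective⟩
  haveI : Epi p := Flat.epi_of_flat_of_surjective p
  haveI : Surjective π₁ := ⟨hπ₁.surjective⟩
  have HA : IsPullback A₁.X.hom π₁ p B₁.X.hom := H₁.flip
  haveI : Flat π₁ := MorphismProperty.of_isPullback HA ‹Flat p›
  haveI : Epi π₁ := Flat.epi_of_flat_of_surjective π₁
  haveI : Epi (pullback.map A₁.X.hom A₁.X.hom B₁.X.hom B₁.X.hom π₁ π₁ p HA.w HA.w) :=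
    hq.epi_pullbackMap_of_free hfree HA HA
  -- the descended morphism
  have hinv : ∀ g : G, (ρA₁.aut g).hom ≫ (f.left ≫ π₂) = f.left ≫ π₂ := fun g => by
    rw [← Category.assoc, hf g, Category.assoc, ρA₂.aut_comp]
  obtain ⟨m, hm⟩ : ∃ m : B₁.X.left ⟶ B₂.X.left, π₁ ≫ m = f.left ≫ π₂ := ⟨hπ₁.desc _ hinv, hπ₁.comp_desc _ hinv⟩
  have hmw : m ≫ B₂.X.hom = B₁.X.hom := by
    rw [← cancel_epi π₁, reassoc_of% hm, w₂, ← Category.assoc, Over.w f, ← w₁]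
  obtain ⟨fB, hfB⟩ : ∃ fB : B₁.X ⟶ B₂.X, fB.left = m := ⟨Over.homMk m hmw, rfl⟩
  have hm' : f.left ≫ π₂ = π₁ ≫ fB.left := by rw [hfB, hm]
  refine ⟨fB, ⟨?_, ?_⟩, hm'⟩
  · -- units
    ext
    rw [Over.comp_left, hfB, ← cancel_epi p, ← Category.assoc, ← u₁, Category.assoc, hm,
      ← Category.assoc, ← Over.comp_left, IsMonHom.one_hom, u₂]
  · -- laws
    ext
    rw [Over.comp_left, Over.comp_left,
      ← cancel_epi (pullback.map A₁.X.hom A₁.X.hom B₁.X.hom B₁.X.hom π₁ π₁ p HA.w HA.w), ← Category.assoc, ← m₁,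
      Category.assoc, hfB, hm, ← Category.assoc, ← Over.comp_left, IsMonHom.mul_hom, Over.comp_left, Category.assoc,
      m₂, MonoidalCategory.tensorHom_def, MonoidalCategory.tensorHom_def, Over.comp_left, Over.comp_left,
      Category.assoc, Category.assoc,
      reassoc_of% (OverBaseMap.map_comp_whiskerRight_left p f fB π₁ π₂ π₁ HA.w H₂.flip.w HA.w hm'),
      reassoc_of% (OverBaseMap.map_comp_whiskerLeft_left p f fB π₁ π₂ π₂ HA.w H₂.flip.w H₂.flip.w hm')]

omit [Fintype G] [IsAffineHom p] in
include hπ₁ in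
/-- **The descended morphism is unique**: two morphisms `B₁ → B₂` under the same `f` agree (`π₁` is an epimorphism
onto its image scheme: surjective and flat is not even needed — a geometric quotient map is an epimorphism of schemes
once flat; here we use uniqueness of descent, ★ `IsGeometricQuotient.desc_unique`).
[cite: MumfordAV1970, §7 Thm. p. 66, Remark] [cite: SGA1, Exp. V Prop. 1.1] -/
theorem desc_left_unique_of_free_base_quotient (fB fB' : B₁.X ⟶ B₂.X)
    (h : π₁ ≫ fB.left = π₁ ≫ fB'.left) : fB = fB' :=
  Over.OverMorphism.ext (hπ₁.desc_unique h)

end Hom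

/-! ### §2 Sections descend -/

section Sections

variable {A : AbelianSchemeOver S} {B : AbelianSchemeOver Q} {π : A.X.left ⟶ B.X.left}
  (h : A.IsBaseChangeVia B p π) (ρA : ActionOver π G) [B.X.left.IsSeparated]

include hq hfree h in
/-- **AN EQUIVARIANT SECTION DESCENDS ALONG A FREE FINITE QUOTIENT OF THE BASE.**  In the SETTING of the module
docstring, a section `σ : S → A` (a morphism `𝟙 → A` of `Over S`) with `ρ(g) ≫ σ = σ ≫ ρA(g)` descends to a section
`τ : Q → B` with `σ ≫ π = p ≫ τ` — the shape of the level-structure clause of ★ `LevelStructure.IsBaseChangeVia`.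
[cite: MumfordFogartyKirwan1994, Ch. 7 §2 Definition 7.2 (p. 129) and §3 Lemma 7.11 (p. 140)] [cite: SGA1, Exp. VIII Cor. 7.8] -/
theorem exists_section_desc_of_free_base_quotient (σ : 𝟙_ (Over S) ⟶ A.X)
    (hσ : ∀ g : G, (ρ.aut g).hom ≫ σ.left = σ.left ≫ (ρA.aut g).hom) :
    ∃ τ : 𝟙_ (Over Q) ⟶ B.X, σ.left ≫ π = p ≫ τ.left := by
  obtain ⟨w, -, -, -⟩ := h
  haveI : Flat p := hq.flat_of_free hfree
  haveI : Surjective p := ⟨hq.surjective⟩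
  haveI : Epi p := Flat.epi_of_flat_of_surjective p
  have hinv : ∀ g : G, (ρ.aut g).hom ≫ (σ.left ≫ π) = σ.left ≫ π := fun g => by
    rw [← Category.assoc, hσ g, Category.assoc, ρA.aut_comp]
  obtain ⟨t, ht⟩ : ∃ t : Q ⟶ B.X.left, p ≫ t = σ.left ≫ π := ⟨hq.desc _ hinv, hq.comp_desc _ hinv⟩
  have htw : t ≫ B.X.hom = (𝟙_ (Over Q)).hom := by
    rw [← cancel_epi p, reassoc_of% ht, w, ← Category.assoc, Over.w σ]
    exact (Category.id_comp p).trans (Category.comp_id p).symm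
  exact ⟨Over.homMk t htw, ht.symm⟩

end Sections

end Literature.AlgebraicGeometry.AbelianSchemes.AbelianSchemeOver

end
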